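/-
Copyright (c) 2026 the pub-hodgecm-mathlib formalisation cell (harness21).  Prover seat hodgecm-mathlib-LH4-p11 (g5), req620 Track A «(D-RAM) FOUR-FRAME» squad
(unit U2H_HSide, the (ρ2b′-X) road :418; bottom socket (A), GAP-lev of the parts list 2026-09-04T06:35Z).
-/
import Literature.NumberTheory.Automorphic.UnitaryThreeFourFrameDefs   -- ★ (valued-field letters; `IsRamifiedQuadraticDatum` for the `|2| = |ϖ|^tE` clause)
import HarnessLib

/-!
# Crux `H413`, line LH4 «(D-RAM) FOUR-FRAME» — the (ρ2b′-X) road, bottom sockets: THE LEVEL DICTIONARY `jl = 2n + d_K` BETWEEN THE LINE-MODEL CONDUCTOR LEVEL AND THE H-SIDE LEVEL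

Cell `hodgecm-mathlib` (D-0151), FLOOR 0, crux item H413 = `stmt-HodgeConjecture-24833`; squad F0∕P3c∕LH4; bottom sockets (A)∕(B)∕(C) of the (ρ2b′-X) payer chain.  THEOREMS ONLY (no
`def`, no instance, no notation, no `sorry`, default heartbeats); lane `--supports stmt-HodgeConjecture-24833 --as helper` (count-neutral).  ABSTRACT letters: `E` (place field,
uniformiser `ϖ`), `M` (line-model field, involution `ρ`), `jE : E →+* M` an ISOMETRY (type U, ★ p10's e = 1 dictionary).
* `sq_sub_map_eq_map_disc` — from the eigen-package letters `ρλ = jE t − λ`, `λ² = jE t·λ − jE D`: `(λ − ρλ)² = jE (t² − 4D)`.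
* `condLevel_eq_of_hlev` — GAP-lev: with `|λ − ρλ| = exp(−jl)` (the T5s weld's `hjl`), ★ (C2) `hSide_closedForm_of_tube*`'s level identity `|ϖ|^{2(2n+d_K)}·|t|² = |4(t² − 4D)|`
  and `|t| = |2| ≠ 0` (γ_H in the tube): `jl = 2n + d_K` — so on the K-unramified branch (`d_K = 0`) the weld's `jl` is `2n` and EVEN (its `hjl2`), and the H-side `N_V = 1 + (q+1)[n]_q`
  is the weld's `1 + (q+1)[jl∕2]_q` (★ `census_bottom_arith_inert`'s `hH` at the same `n`).
HONEST LABEL.  Count-neutral; nothing printed is asserted; (ρ2b′-X) stays OPEN; `HC_CM` is proved only modulo the 7 printed citations (2 remaining named inputs: hLiu418 =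
`stmt-HodgeConjecture-24832`, h413 = `stmt-HodgeConjecture-24833`) until rung 0 closes.

## References
* [Rogawski1990] J. D. Rogawski, *Automorphic Representations of Unitary Groups in Three Variables*, Ann. of Math. Stud. 123 (1990), §4.9 Prop. 4.9.1 (b) p. 55, Lemma 4.9.3 p. 56.
* [LabesseLanglands1979] J.-P. Labesse, R. P. Langlands, *L-indistinguishability for SL(2)*, Canad. J. Math. 31 (1979), §2 pp. 7–8 (the level of a torus element).
-/

set_option autoImplicit false

noncomputable section

open scoped Valued WithZero
open WithZero

namespace Summit.HodgeConjecture.HodgeConjecture.Cruxes.H413.F0P3cDyRamTypeTwoLevelDictionary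

variable {E : Type*} {M : Type*} [Field E] [Valued E ℤᵐ⁰] [Field M] [Valued M ℤᵐ⁰] {ρ : M →+* M}

omit [Valued E ℤᵐ⁰] [Valued M ℤᵐ⁰] in
/-- **`(λ − ρλ)² = jE (t² − 4D)`** from the eigen-package letters `ρλ = jE t − λ` and `λ² = jE t·λ − jE D`. [cite: Rogawski1990, §4.9 Lemma 4.9.3 p. 56] -/
theorem sq_sub_map_eq_map_disc (jE : E →+* M) {lam : M} {t D : E} (hρlam : ρ lam = jE t - lam) (hlam2 : lam * lam = jE t * lam - jE D) :
    (lam - ρ lam) ^ 2 = jE (t ^ 2 - 4 * D) := by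
  rw [hρlam, map_sub, map_mul, map_pow, map_ofNat]
  linear_combination (4 : M) * hlam2

/-- Powers of a uniformiser's value: `|ϖ|^k = exp(−k)`. [cite: LabesseLanglands1979, §2 pp. 7–8] -/
theorem v_pow_eq_exp_neg {ϖ : E} (hϖ : Valued.v ϖ = exp (-1 : ℤ)) (k : ℕ) : Valued.v ϖ ^ k = exp (-(k : ℤ)) := by
  rw [hϖ, ← exp_nsmul]; congr 1; simp

/-- **GAP-lev: `jl = 2n + d_K`.**  If `jE` is an isometry, `(λ − ρλ)² = jE(t² − 4D)`, `|λ − ρλ| = exp(−jl)`, the H-side level identity `|ϖ|^{2(2n+d_K)}·|t|² = |4·(t² − 4D)|`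
holds and `|t| = |2| ≠ 0` (the element is in the tube), then `jl = 2n + d_K`. [cite: LabesseLanglands1979, §2 pp. 7–8] [cite: Rogawski1990, §4.9 Lemma 4.9.3 p. 56] -/
theorem condLevel_eq_of_hlev (jE : E →+* M) (hiso : ∀ x, Valued.v (jE x) = Valued.v x) {ϖ : E} (hϖ : Valued.v ϖ = exp (-1 : ℤ))
    {lam : M} {t D : E} (hsq : (lam - ρ lam) ^ 2 = jE (t ^ 2 - 4 * D)) {jl : ℕ} (hjl : Valued.v (lam - ρ lam) = exp (-(jl : ℤ)))
    {n dK : ℕ} (hlev : Valued.v ϖ ^ (2 * (2 * n + dK)) * Valued.v t ^ 2 = Valued.v (4 * (t ^ 2 - 4 * D)))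
    (htr : Valued.v t = Valued.v (2 : E)) (h20 : Valued.v (2 : E) ≠ 0) : jl = 2 * n + dK := by
  -- `|t² − 4D| = exp(−2 jl)`
  have hdisc : Valued.v (t ^ 2 - 4 * D) = exp (-(2 * (jl : ℤ))) := by
    rw [← hiso, ← hsq, map_pow, hjl, ← exp_nsmul]; congr 1; simp [two_mul]
  -- `|4 (t² − 4D)| = |2|² · |t² − 4D|` and cancel `|t|² = |2|²`
  have h4 : Valued.v (4 * (t ^ 2 - 4 * D)) = Valued.v (2 : E) ^ 2 * Valued.v (t ^ 2 - 4 * D) := by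
    rw [map_mul, show (4 : E) = 2 ^ 2 by norm_num, map_pow]
  rw [h4, htr, mul_comm] at hlev
  have hcancel : Valued.v ϖ ^ (2 * (2 * n + dK)) = Valued.v (t ^ 2 - 4 * D) := mul_left_cancel₀ (pow_ne_zero 2 h20) hlev
  rw [v_pow_eq_exp_neg hϖ, hdisc, exp_inj] at hcancel
  push_cast at hcancel
  omega

end Summit.HodgeConjecture.HodgeConjecture.Cruxes.H413.F0P3cDyRamTypeTwoLevelDictionary

end
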